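import Mathlib
import HarnessLib
import Summits.NavierStokesRegularity.NavierStokesRegularity.Theorems.PoloidalWindowDoorLrcModEntireRidgeHull
import Summits.NavierStokesRegularity.NavierStokesRegularity.Theorems.PoloidalWindowDoorLrcModEntireRidgeBranchRegularity
import Summits.NavierStokesRegularity.NavierStokesRegularity.Theorems.PoloidalWindowDoorLrcModEntireTwistingTHRidgeQuasiconvexTools

/-!
# Item `LrcModEntire` (stmt-NavierStokesRegularity-20428) — (Q3) RE-ENTRY: the hull limit and its limit branch satisfy the hypotheses of the hull step again
# (so the hull step ITERATES), and the limit of the ridge coefficient exists from quasiconvexity on compact sub-arcs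

ns-k2-port-2 g5 (helper prover under the LEAD of item 20428, ns-poloidal-K2-p3 g14; `--supports stmt-NavierStokesRegularity-20428 --as helper`).
Memo `Cruxes/LrcModEntire/T2B-g14.md` §10 (Q3) «iterating … and extracting diagonally»: each round re-pins along the limit branch of the previous round.  This file
closes the loop for the second-order machinery:

* `fderiv_two_eq_zero_of_hot` — in the pinned class the hot set is CRITICAL for free: `√(−t)|U₂(t,x)| ≤ |U₂(−1,0)|` (Type-I extremality at the pin, a class clause preserved
  by `hullLimit`) makes every hot point a global extremum of `U₂(−1,·)`, hence `∇U₂(−1,·) = 0` there (Fermat) — the `hcrit` input of `…RidgeHull.exists_hullLimit_branch`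
  and of the LEAD's `…RidgeClass`;
* `exists_hullLimit_branch_reentry` — the hull step `exists_hullLimit_branch` with its output REPACKAGED AS INPUT: along a subsequence the hull limit `U` (pinned, peakless,
  same hot value, critical hot set) carries the limit branch `Γ`, which is `C^∞` (`…RidgeBranchRegularity.contDiff_of_unitSpeed_criticalBranch`), lies in `P₀`, has unit
  speed, is hot for `U`, and is uniformly non-degenerate with the SAME `κ₀` for the in-plane normal `ν_Γ = (−Γ′₁, Γ′₀, 0)`; so `exists_hullLimit_branch C U …` applies to
  `(U, Γ)` verbatim (next round), and all second-order data along `γ(s_{φ k} + ·)` converge to those of `U` along `Γ`;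
* `quasiconvexOn_Ici_of_forall_Icc`, `exists_tendsto_ridgeCoeff` — quasiconvexity on every compact sub-arc `[a, b]` (what `…RidgeClass.quasiconvexOn_ridgeCoeff_of_class`
  delivers, with its per-arc thin tube) is quasiconvexity on `[a, ∞)`, and with a bound `|R| ≤ M` the limit `L = lim_{s→∞} R(s)` exists (port-2 g4's
  `…TwistingTHRidgeQuasiconvexTools.exists_tendsto_atTop_of_abs_le`) — the `hR` input of `…RidgeHullConst.exists_hullLimit_branch_ridgeCoeff_eq`.

WHAT THIS IS NOT: not a claim about Navier–Stokes regularity — bookkeeping for the (Q3) hull iteration on hypothetical profiles (bears_on LADDER-NS N0, item 20428 / crux 19708;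
20428/19708/27893 OPEN); the higher-order / time-direction coefficient functionals and the diagonal over orders are the LEAD's; (Q4) OPEN.  No summit statement is proved here.
-/

noncomputable section

-- the summit and its single sub-problem share the name (CONVENTIONS §1), as in every Theorems file
set_option linter.dupNamespace false

namespace Summit.NavierStokesRegularity.NavierStokesRegularity.Theorems.PoloidalWindowDoorLrcModEntireRidgeHullIterate

open Set Filter Topology Metric Function
open scoped ContDiff InnerProductSpace RealInnerProductSpace Laplacian
open Literature.Analysis Literature.Analysis.FluidPDE
open Summit.NavierStokesRegularity.NavierStokesRegularity.Theorems.LocalSineTubeDoorProfileAlignedWindowRigidityAncient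
open Summit.NavierStokesRegularity.NavierStokesRegularity.Theorems.PoloidalWindowDoorLrcModEntireRidgeHull
open Summit.NavierStokesRegularity.NavierStokesRegularity.Theorems.PoloidalWindowDoorLrcModEntireRidgeBranchRegularity
open Summit.NavierStokesRegularity.NavierStokesRegularity.Theorems.PoloidalWindowDoorLrcModEntireTwistingTHRidgeQuasiconvexTools

/-! ### Hot points of a pinned profile are critical -/

/-- **In the pinned class the hot set is critical** (Fermat at a global extremum of `U₂(−1,·)`, from the Type-I extremality clause at `t = −1`). -/
theorem fderiv_two_eq_zero_of_hot {U : ℝ → EuclideanSpace ℝ (Fin 3) → EuclideanSpace ℝ (Fin 3)}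
    (hext : ∀ t < 0, ∀ x, Real.sqrt (-t) * |U t x 2| ≤ |U (-1) 0 2|) :
    ∀ y ∈ {y : EuclideanSpace ℝ (Fin 3) | y 2 = 0 ∧ U (-1) y 2 = U (-1) 0 2}, fderiv ℝ (fun x => U (-1) x 2) y = 0 := by
  rintro y ⟨-, hy⟩
  have hle : ∀ x, |U (-1) x 2| ≤ |U (-1) 0 2| := fun x => by
    have h := hext (-1) (by norm_num) x
    rwa [neg_neg, Real.sqrt_one, one_mul] at h
  rcases le_or_gt 0 (U (-1) 0 2) with hN | hN
  · -- `y` is a global maximum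
    have hmax : IsMaxOn (fun x => U (-1) x 2) univ y := fun x _ => by
      have h := hle x
      rw [abs_of_nonneg hN] at h
      show U (-1) x 2 ≤ U (-1) y 2
      rw [hy]; exact (le_abs_self _).trans h
    exact (hmax.isLocalMax univ_mem).fderiv_eq_zero
  · -- `y` is a global minimum
    have hmin : IsMinOn (fun x => U (-1) x 2) univ y := fun x _ => by
      have h := hle x
      rw [abs_of_neg hN] at h
      show U (-1) y 2 ≤ U (-1) x 2
      rw [hy]; linarith [neg_abs_le (U (-1) x 2)]
    exact (hmin.isLocalMin univ_mem).fderiv_eq_zero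

/-! ### Quasiconvexity on compact sub-arcs ⇒ a limit at `+∞` -/

/-- Quasiconvexity on every `[a, b]` is quasiconvexity on `[a, ∞)`. [folklore] -/
theorem quasiconvexOn_Ici_of_forall_Icc {R : ℝ → ℝ} {a : ℝ} (h : ∀ b, a ≤ b → QuasiconvexOn ℝ (Icc a b) R) :
    QuasiconvexOn ℝ (Ici a) R := by
  rw [quasiconvexOn_iff_le_max]
  refine ⟨convex_Ici a, fun x hx y hy u w hu hw huw => ?_⟩
  have hq := (quasiconvexOn_iff_le_max.1 (h (max x y) (le_trans hx (le_max_left _ _)))).2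
  exact hq ⟨hx, le_max_left _ _⟩ ⟨hy, le_max_right _ _⟩ hu hw huw

/-- **The ridge coefficient has a limit at `+∞`** once it is quasiconvex on every compact sub-arc of a half-branch and bounded there. -/
theorem exists_tendsto_ridgeCoeff {R : ℝ → ℝ} {a M : ℝ} (h : ∀ b, a ≤ b → QuasiconvexOn ℝ (Icc a b) R)
    (hM : ∀ s, a ≤ s → |R s| ≤ M) : ∃ L : ℝ, Tendsto R atTop (𝓝 L) :=
  exists_tendsto_atTop_of_abs_le (quasiconvexOn_Ici_of_forall_Icc h) hM

/-! ### Re-entry -/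

/-- **(Q3) RE-ENTRY OF THE HULL STEP.**  Hypotheses exactly as in `…RidgeHull.exists_hullLimit_branch`; the conclusion lists the hull limit `U`, the limit branch `Γ` and,
besides the convergence statements, the INPUT PACKAGE of `exists_hullLimit_branch` for `(U, Γ)`: critical hot set of `U`, `Γ ∈ C^∞`, `Γ ⊂ P₀`, unit speed, hot for `U`,
and `κ₀ ≤ −D²(σU₂(−1,·))(Γ s)(ν_Γ s)(ν_Γ s)` with `ν_Γ s = (−Γ′ s 1, Γ′ s 0, 0)`. -/
theorem exists_hullLimit_branch_reentry (C : ℝ) (v : ℝ → EuclideanSpace ℝ (Fin 3) → EuclideanSpace ℝ (Fin 3))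
    (hP : (Literature.Analysis.FluidPDE.HasTypeITimeDecay C v ∧
        ContinuousOn (Function.uncurry v) (Set.Iio (0 : ℝ) ×ˢ Set.univ) ∧
        (∀ s t : ℝ, s < t → t < 0 → ∀ x, v t x =
          Literature.Analysis.UnboundedOperators.heatExtension (v s) (t - s) x -
            Literature.Analysis.FluidPDE.oseenDuhamel 1 s v v t x) ∧
        (∀ t < 0, Literature.Analysis.FluidPDE.VectorCalculus.IsDivFree (v t)) ∧
        (∀ s < 0, ∀ q, ⟪Literature.Analysis.FluidPDE.curl (v s) q, EuclideanSpace.single 2 1⟫_ℝ = 0) ∧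
        v (-1) 0 2 ≠ 0 ∧ (∀ t < 0, ∀ x, Real.sqrt (-t) * |v t x 2| ≤ |v (-1) 0 2|) ∧
        (∀ h : EuclideanSpace ℝ (Fin 3), fderiv ℝ (v (-1)) 0 h 2 = 0) ∧
        (deriv (fun s => v s 0 2) (-1) = v (-1) 0 2 / 2 ∧ v (-1) 0 2 * (Δ (fun q => v (-1) q 2)) 0 ≤ 0)))
    (hK : (∀ (s z₀ σ M : ℝ) (K O : Set (EuclideanSpace ℝ (Fin 3))), s < 0 →
        ((σ = 1 ∨ σ = -1) ∧ IsCompact K ∧ K.Nonempty ∧ (∀ q ∈ K, q 2 = z₀ ∧ σ * v s q 2 = M) ∧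
          IsOpen O ∧ K ⊆ O ∧ (∀ q ∈ O, q 2 = z₀ → σ * v s q 2 ≤ M) ∧
          (∀ q ∈ O, q 2 = z₀ → σ * v s q 2 = M → q ∈ K)) → False))
    {σ : ℝ} (hσ : σ = 1 ∨ σ = -1)
    {γ : ℝ → EuclideanSpace ℝ (Fin 3)} (hγ2 : ContDiff ℝ 2 γ) (hplane : ∀ s, γ s 2 = 0) (hunit : ∀ s, ‖deriv γ s‖ = 1)
    (hhot : ∀ s, v (-1) (γ s) 2 = v (-1) 0 2)
    {ν : ℝ → EuclideanSpace ℝ (Fin 3)} (hν : ∀ s, ν s = WithLp.toLp 2 ![-(deriv γ s 1), deriv γ s 0, 0])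
    {κ₀ : ℝ} (hκ₀ : 0 < κ₀) (hκ : ∀ s, κ₀ ≤ -(fderiv ℝ (fderiv ℝ (fun y => σ * v (-1) y 2)) (γ s) (ν s) (ν s)))
    (sq : ℕ → ℝ) :
    ∃ (φ : ℕ → ℕ) (U : ℝ → EuclideanSpace ℝ (Fin 3) → EuclideanSpace ℝ (Fin 3)) (Γ : ℝ → EuclideanSpace ℝ (Fin 3)), StrictMono φ ∧
      (Literature.Analysis.FluidPDE.HasTypeITimeDecay C U ∧
        ContinuousOn (Function.uncurry U) (Set.Iio (0 : ℝ) ×ˢ Set.univ) ∧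
        (∀ s t : ℝ, s < t → t < 0 → ∀ x, U t x =
          Literature.Analysis.UnboundedOperators.heatExtension (U s) (t - s) x -
            Literature.Analysis.FluidPDE.oseenDuhamel 1 s U U t x) ∧
        (∀ t < 0, Literature.Analysis.FluidPDE.VectorCalculus.IsDivFree (U t)) ∧
        (∀ s < 0, ∀ q, ⟪Literature.Analysis.FluidPDE.curl (U s) q, EuclideanSpace.single 2 1⟫_ℝ = 0) ∧
        U (-1) 0 2 ≠ 0 ∧ (∀ t < 0, ∀ x, Real.sqrt (-t) * |U t x 2| ≤ |U (-1) 0 2|) ∧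
        (∀ h : EuclideanSpace ℝ (Fin 3), fderiv ℝ (U (-1)) 0 h 2 = 0) ∧
        (deriv (fun s => U s 0 2) (-1) = U (-1) 0 2 / 2 ∧ U (-1) 0 2 * (Δ (fun q => U (-1) q 2)) 0 ≤ 0)) ∧
      (∀ (s z₀ σ M : ℝ) (K O : Set (EuclideanSpace ℝ (Fin 3))), s < 0 →
        ((σ = 1 ∨ σ = -1) ∧ IsCompact K ∧ K.Nonempty ∧ (∀ q ∈ K, q 2 = z₀ ∧ σ * U s q 2 = M) ∧
          IsOpen O ∧ K ⊆ O ∧ (∀ q ∈ O, q 2 = z₀ → σ * U s q 2 ≤ M) ∧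
          (∀ q ∈ O, q 2 = z₀ → σ * U s q 2 = M → q ∈ K)) → False) ∧
      U (-1) 0 2 = v (-1) 0 2 ∧
      (∀ t < 0, TendstoLocallyUniformly (fun j x => v t (x + γ (sq (φ j)))) (U t) atTop) ∧
      (∀ s, Tendsto (fun j => γ (sq (φ j) + s) - γ (sq (φ j))) atTop (𝓝 (Γ s))) ∧
      (∀ s, Tendsto (fun j => deriv γ (sq (φ j) + s)) atTop (𝓝 (deriv Γ s))) ∧
      (∀ s, ∀ (m₁ m₂ : ℕ → EuclideanSpace ℝ (Fin 3)) (l₁ l₂ : EuclideanSpace ℝ (Fin 3)),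
        Tendsto m₁ atTop (𝓝 l₁) → Tendsto m₂ atTop (𝓝 l₂) →
        Tendsto (fun j => fderiv ℝ (fderiv ℝ (fun y => σ * v (-1) y 2)) (γ (sq (φ j) + s)) (m₁ j) (m₂ j)) atTop
          (𝓝 (fderiv ℝ (fderiv ℝ (fun y => σ * U (-1) y 2)) (Γ s) l₁ l₂))) ∧
      -- RE-ENTRY PACKAGE for `(U, Γ)`
      (∀ y ∈ {y : EuclideanSpace ℝ (Fin 3) | y 2 = 0 ∧ U (-1) y 2 = U (-1) 0 2}, fderiv ℝ (fun x => U (-1) x 2) y = 0) ∧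
      ContDiff ℝ ∞ Γ ∧ Γ 0 = 0 ∧ (∀ s, Γ s 2 = 0) ∧ (∀ s, ‖deriv Γ s‖ = 1) ∧ (∀ s, U (-1) (Γ s) 2 = U (-1) 0 2) ∧
      (∀ s, κ₀ ≤ -(fderiv ℝ (fderiv ℝ (fun y => σ * U (-1) y 2)) (Γ s)
          (WithLp.toLp 2 ![-(deriv Γ s 1), deriv Γ s 0, 0]) (WithLp.toLp 2 ![-(deriv Γ s 1), deriv Γ s 0, 0]))) := by
  have hneg : (-1 : ℝ) < 0 := by norm_num
  -- the hot set of `v` is critical (class), so the hull step applies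
  have hcritv := fderiv_two_eq_zero_of_hot (U := v) hP.2.2.2.2.2.2.1
  obtain ⟨φ, U, Γ, hφ, hPU, hKU, hUN, hconv, hΓ1, hΓ0, hΓplane, hΓunit, -, hptγ, hptγ', hptν, hΓhot, hΓcrit, hsecond⟩ :=
    exists_hullLimit_branch C v hP hK hcritv hσ hγ2 hplane hunit hhot hν hκ₀ hκ sq
  -- the hot set of `U` is critical (class clause preserved by the hull limit)
  have hcritU := fderiv_two_eq_zero_of_hot (U := U) hPU.2.2.2.2.2.2.1
  -- non-degeneracy passes to the limit along the converging normals
  have hκU : ∀ s, κ₀ ≤ -(fderiv ℝ (fderiv ℝ (fun y => σ * U (-1) y 2)) (Γ s)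
      (WithLp.toLp 2 ![-(deriv Γ s 1), deriv Γ s 0, 0]) (WithLp.toLp 2 ![-(deriv Γ s 1), deriv Γ s 0, 0])) := fun s =>
    ge_of_tendsto' ((hsecond s _ _ _ _ (hptν s) (hptν s)).neg) fun j => hκ _
  -- the limit branch is smooth
  have hsliceU : ContDiff ℝ ∞ (U (-1)) :=
    (analyticOnNhd_slice hPU.2.1 (bdd_of_hasTypeITimeDecay hPU.1) hPU.2.2.1 hneg).contDiff
  have hfU : ContDiff ℝ ∞ (fun y => σ * U (-1) y 2) := contDiff_signed hsliceU σ
  have hU2d : Differentiable ℝ (fun y => U (-1) y 2) :=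
    ((contDiff_piLp_apply (p := 2) (𝕜 := ℝ) (E := fun _ : Fin 3 => ℝ) (i := (2 : Fin 3))).comp hsliceU).differentiable (by simp)
  have hfUcrit : ∀ s, fderiv ℝ (fun y => σ * U (-1) y 2) (Γ s) = 0 := fun s => by
    rw [fderiv_const_mul (hU2d _), hΓcrit s, smul_zero]
  have hΓsmooth : ContDiff ℝ ∞ Γ :=
    contDiff_of_unitSpeed_criticalBranch hfU hΓ1 hΓplane hΓunit hfUcrit hκ₀ fun s => by linarith [hκU s]
  exact ⟨φ, U, Γ, hφ, hPU, hKU, hUN, hconv, hptγ, hptγ', hsecond, hcritU, hΓsmooth, hΓ0, hΓplane, hΓunit, hΓhot, hκU⟩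

end Summit.NavierStokesRegularity.NavierStokesRegularity.Theorems.PoloidalWindowDoorLrcModEntireRidgeHullIterate

end
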